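import Summits.RiemannHypothesis.RiemannHypothesis.Theses.SpectralTrace
import Summits.RiemannHypothesis.RiemannHypothesis.Theorems.SpectralTraceSpectralThesisClosedLadderCells
import Literature.NumberTheory.LFunctions.WeilMellinInversion
import Literature.NumberTheory.LFunctions.WeilMellinBounds
import HarnessLib

/-!
# Poisson summation in the phase variable (`stub_hbPoisson`)

Stub `stub_hbPoisson` of the line `Sketch` of the crux `SpectralThesis`
(stmt-RiemannHypothesis-0187), the Poisson half of the Hermite–Biehler window trace theorem.

Let `Φ ∈ C¹(ℝ)` with `Φ' ≥ b > 0` and `Φ' ≤ C(1 + log(1+|x|))`, let `t : ℤ → ℝ` be the level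
sequence `Φ(t m) = π(m + 1/2)`, and let `g` be a Weil test with `ĝ(x) = weilMellin g (1/2 + xI)`.
If the aliasing integrals `∫ ĝ Φ' e^{-2inΦ}` vanish for `n ≠ 0`, then

  `HasSum (m ↦ ĝ(t m)) ((1/π) ∫ ĝ Φ')`.

## Proof

`Φ` is a strictly increasing homeomorphism of `ℝ` (derivative `≥ b > 0`), with continuous inverse
`Ψ`. Put `f(u) := ĝ(Ψ(π(u + 1/2)))`, so `f(m) = ĝ(t m)`. Two integrations by parts
(`ClosedLadder.norm_weilMellin_line_le_sq`, i.e. `norm_weilMellin_le` for `g` and `g''`) give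
`‖ĝ(x)‖ ≤ D/(1+x²)²`, and the mean value theorem gives
`|Φ(x) - Φ(0)| ≤ C(1+|x|)|x| ≤ 2C(1+x²)`, whence `f = O(|u|⁻²)` at infinity. The change of
variables `u = Φ(x)/π - 1/2` (`integral_image_eq_integral_deriv_smul_of_monotoneOn`) computes the
Fourier transform `𝓕 f (w) = (e^{iπw}/π) ∫ ĝ Φ' e^{-2iwΦ}`, which vanishes at every non-zero
integer by hypothesis and equals `(1/π)∫ ĝ Φ'` at `w = 0`. Mathlib's Poisson summation formula
`Real.tsum_eq_tsum_fourier_of_rpow_decay_of_summable` then gives `∑ f(m) = 𝓕 f 0`, and the decay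
makes `m ↦ f(m)` summable, so the sum is a `HasSum`.

All ingredients are classical (folklore): Poisson summation (Stein–Weiss, *Introduction to Fourier
analysis on Euclidean spaces*, Cor. VII.2.6) and the one-dimensional change of variables formula.
-/

noncomputable section

set_option linter.dupNamespace false

open Complex Set MeasureTheory Filter Topology Asymptotics
open scoped Real FourierTransform
open Literature.NumberTheory.LFunctions

namespace Summit.RiemannHypothesis.RiemannHypothesis.Theorems.SpectralThesis.Sketch

/-- A `C¹` function `Φ : ℝ → ℝ` with `Φ' ≥ b > 0` is a strictly increasing homeomorphism of `ℝ`: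
it has a continuous, strictly increasing two-sided inverse `Ψ`. [folklore] -/
theorem hbPoisson_exists_inverse {b : ℝ} (hb : 0 < b) {Φ : ℝ → ℝ} (hΦ : ContDiff ℝ 1 Φ)
    (hΦb : ∀ x, b ≤ deriv Φ x) :
    ∃ Ψ : ℝ → ℝ, Continuous Ψ ∧ StrictMono Ψ ∧ (∀ x, Ψ (Φ x) = x) ∧ ∀ v, Φ (Ψ v) = v := by
  have hd : Differentiable ℝ Φ := hΦ.differentiable one_ne_zero
  have hmono : StrictMono Φ := strictMono_of_deriv_pos fun x ↦ hb.trans_le (hΦb x)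
  -- `Φ x - b x` is monotone
  have hlin : Monotone fun x ↦ Φ x - b * x := by
    have hD : ∀ x, HasDerivAt (fun x : ℝ ↦ Φ x - b * x) (deriv Φ x - b) x := fun x ↦
      (hd x).hasDerivAt.fun_sub (hasDerivAt_const_mul b)
    refine monotone_of_deriv_nonneg (fun x ↦ (hD x).differentiableAt) fun x ↦ ?_
    rw [(hD x).deriv]
    linarith [hΦb x]
  have htop : Tendsto Φ atTop atTop := by
    refine tendsto_atTop_atTop.2 fun B ↦ ⟨max 0 ((B - Φ 0) / b), fun x hx ↦ ?_⟩
    have h0 : (0 : ℝ) ≤ x := le_of_max_le_left hx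
    have h1 := hlin h0
    simp only [mul_zero, sub_zero] at h1
    have h2 : (B - Φ 0) / b ≤ x := le_of_max_le_right hx
    rw [div_le_iff₀ hb] at h2
    linarith
  have hbot : Tendsto Φ atBot atBot := by
    refine tendsto_atBot_atBot.2 fun B ↦ ⟨min 0 ((B - Φ 0) / b), fun x hx ↦ ?_⟩
    have h0 : x ≤ 0 := hx.trans (min_le_left _ _)
    have h1 := hlin h0
    simp only [mul_zero, sub_zero] at h1
    have h2 : x ≤ (B - Φ 0) / b := hx.trans (min_le_right _ _)
    rw [le_div_iff₀ hb] at h2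
    linarith
  have hsurj : Function.Surjective Φ := hΦ.continuous.surjective htop hbot
  refine ⟨(hmono.orderIsoOfSurjective Φ hsurj).symm, OrderIso.continuous _, OrderIso.strictMono _,
    fun x ↦ hmono.orderIsoOfSurjective_symm_apply_self Φ hsurj x,
    fun v ↦ hmono.orderIsoOfSurjective_self_symm_apply Φ hsurj v⟩

/-- Growth of the phase: if `0 ≤ Φ' ≤ C(1 + log(1+|x|))`, then `|Φ x - Φ 0| ≤ C (1+|x|) |x|`
(mean value theorem, with `log(1+|y|) ≤ |y| ≤ |x|` on the segment `[0, x]`). [folklore] -/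
theorem hbPoisson_abs_sub_le {Φ : ℝ → ℝ} (hΦ : ContDiff ℝ 1 Φ) (hΦ0 : ∀ x, 0 ≤ deriv Φ x)
    {C : ℝ} (hΦg : ∀ x, deriv Φ x ≤ C * (1 + Real.log (1 + |x|))) (x : ℝ) :
    |Φ x - Φ 0| ≤ C * (1 + |x|) * |x| := by
  have hd : Differentiable ℝ Φ := hΦ.differentiable one_ne_zero
  have hC : 0 ≤ C := by
    have := (hΦ0 0).trans (hΦg 0)
    simpa using this
  have key := Convex.norm_image_sub_le_of_norm_deriv_le (f := Φ) (s := Set.uIcc 0 x)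
    (C := C * (1 + |x|)) (fun y _ ↦ hd y) ?_ (convex_uIcc 0 x) left_mem_uIcc right_mem_uIcc
  · simpa using key
  · intro y hy
    have hyx : |y| ≤ |x| := by
      rcases Set.mem_uIcc.1 hy with ⟨h1, h2⟩ | ⟨h1, h2⟩
      · rw [abs_of_nonneg h1]
        exact h2.trans (le_abs_self x)
      · rw [abs_of_nonpos h2, ← abs_neg x]
        exact (neg_le_neg h1).trans (le_abs_self _)
    rw [Real.norm_eq_abs, abs_of_nonneg (hΦ0 y)]
    calc deriv Φ y ≤ C * (1 + Real.log (1 + |y|)) := hΦg y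
      _ ≤ C * (1 + |y|) := by
          gcongr
          have := Real.log_le_sub_one_of_pos (by positivity : (0 : ℝ) < 1 + |y|)
          linarith
      _ ≤ C * (1 + |x|) := by gcongr

/-- Decay transfer through the inverse phase: if `‖G x‖ ≤ D/(1+x²)²`, `|Φ x - Φ 0| ≤ 2C(1+x²)`
(`C > 0`) and `Φ ∘ Ψ = id`, then `u ↦ G(Ψ(π(u + 1/2)))` is `O(|u|⁻²)` along `cocompact ℝ`.
[folklore] -/
theorem hbPoisson_isBigO {G : ℝ → ℂ} {Φ Ψ : ℝ → ℝ} {C D : ℝ} (hC : 0 < C)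
    (hG : ∀ x, ‖G x‖ ≤ D / (1 + x ^ 2) ^ 2) (hΦ : ∀ x, |Φ x - Φ 0| ≤ 2 * C * (1 + x ^ 2))
    (hΦΨ : ∀ v, Φ (Ψ v) = v) :
    (fun u : ℝ ↦ G (Ψ (π * (u + 1 / 2)))) =O[cocompact ℝ] fun u : ℝ ↦ |u| ^ (-2 : ℝ) := by
  have hD : 0 ≤ D := by
    have h := (norm_nonneg _).trans (hG 0)
    simpa using h
  have hπ := Real.pi_pos
  set R : ℝ := 1 + 2 * |Φ 0| / π with hR
  refine IsBigO.of_bound (16 * C ^ 2 * D / π ^ 2) ?_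
  filter_upwards [(isCompact_Icc (a := -R) (b := R)).compl_mem_cocompact] with u hu
  have hu' : R ≤ |u| := by
    simp only [mem_compl_iff, mem_Icc, not_and_or, not_le] at hu
    rcases hu with h | h
    · have : R < -u := by linarith
      exact this.le.trans (neg_le_abs u)
    · exact h.le.trans (le_abs_self u)
  set x : ℝ := Ψ (π * (u + 1 / 2))
  have hΦx : Φ x = π * (u + 1 / 2) := hΦΨ _
  -- lower bound on `1 + x²`
  have hlow : π * |u| / (4 * C) ≤ 1 + x ^ 2 := by
    have h2 := hΦ x
    rw [hΦx] at h2
    have h3 : π * |u| - π / 2 - |Φ 0| ≤ |π * (u + 1 / 2) - Φ 0| := by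
      have h4 := abs_sub_abs_le_abs_sub (π * (u + 1 / 2)) (Φ 0)
      have h5 : π * |u| - π / 2 ≤ |π * (u + 1 / 2)| := by
        rw [abs_mul, abs_of_pos hπ]
        have h6 : |u| ≤ |u + 1 / 2| + 1 / 2 := by
          have := abs_sub (u + 1 / 2) (1 / 2 : ℝ)
          rw [abs_of_pos (by norm_num : (0 : ℝ) < 1 / 2)] at this
          simpa using this
        nlinarith
      linarith
    have h7 : π + 2 * |Φ 0| ≤ π * |u| := by
      have h8 := mul_le_mul_of_nonneg_left hu' hπ.le
      have h9 : π * R = π + 2 * |Φ 0| := by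
        rw [hR]
        field_simp
      linarith
    rw [div_le_iff₀ (by positivity)]
    nlinarith
  have hlow_pos : 0 < π * |u| / (4 * C) := by
    have : 0 < |u| := by
      have : (1 : ℝ) ≤ R := by
        rw [hR]
        have : 0 ≤ 2 * |Φ 0| / π := by positivity
        linarith
      linarith
    positivity
  rw [Real.norm_of_nonneg (Real.rpow_nonneg (abs_nonneg u) _), Real.rpow_neg (abs_nonneg u),
    Real.rpow_two, sq_abs]
  calc ‖G x‖ ≤ D / (1 + x ^ 2) ^ 2 := hG x
    _ ≤ D / (π * |u| / (4 * C)) ^ 2 := by gcongr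
    _ = 16 * C ^ 2 * D / π ^ 2 * (u ^ 2)⁻¹ := by
        field_simp
        rw [sq_abs]
        ring

/-- The Fourier transform of `u ↦ G(Ψ(π(u + 1/2)))` (`Ψ = Φ⁻¹`, `Φ ∈ C¹` strictly increasing
onto `ℝ`) by the change of variables `u = Φ(x)/π - 1/2`:
`𝓕 f (w) = (e^{iπw}/π) ∫ G(x) Φ'(x) e^{-2iwΦ(x)} dx`. [folklore] -/
theorem hbPoisson_fourier_eq {Φ Ψ : ℝ → ℝ} (hΦ : ContDiff ℝ 1 Φ) (hmono : StrictMono Φ)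
    (hΨΦ : ∀ x, Ψ (Φ x) = x) (hΦΨ : ∀ v, Φ (Ψ v) = v) (G : ℝ → ℂ) (w : ℝ) :
    𝓕 (fun u : ℝ ↦ G (Ψ (π * (u + 1 / 2)))) w =
      cexp (π * w * I) / π *
        ∫ x : ℝ, G x * ((deriv Φ x : ℝ) : ℂ) * cexp (-(2 * I * w * Φ x)) := by
  rw [Real.fourier_real_eq_integral_exp_smul]
  have hπ := Real.pi_pos
  have hd : Differentiable ℝ Φ := hΦ.differentiable one_ne_zero
  have hθd : ∀ x, HasDerivAt (fun x ↦ Φ x / π - 1 / 2) (deriv Φ x / π) x := fun x ↦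
    ((hd x).hasDerivAt.div_const π).sub_const (1 / 2)
  have hθm : Monotone fun x ↦ Φ x / π - 1 / 2 := fun x y hxy ↦ by
    simp only
    gcongr
    exact hmono.monotone hxy
  have hθs : (fun x ↦ Φ x / π - 1 / 2) '' univ = univ := by
    rw [Set.image_univ, Set.range_eq_univ]
    intro v
    refine ⟨Ψ (π * (v + 1 / 2)), ?_⟩
    simp only [hΦΨ]
    field_simp
    ring
  have key := integral_image_eq_integral_deriv_smul_of_monotoneOn MeasurableSet.univ
    (fun x _ ↦ (hθd x).hasDerivWithinAt) (hθm.monotoneOn _)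
    (fun v : ℝ ↦ cexp (↑(-2 * π * v * w) * I) • G (Ψ (π * (v + 1 / 2))))
  rw [hθs, Measure.restrict_univ] at key
  rw [key, ← integral_const_mul]
  congr 1 with x
  have h1 : π * (Φ x / π - 1 / 2 + 1 / 2) = Φ x := by
    field_simp
    ring
  rw [h1, hΨΦ]
  have h2 : cexp (↑(-2 * π * (Φ x / π - 1 / 2) * w) * I) =
      cexp (π * w * I) * cexp (-(2 * I * w * Φ x)) := by
    rw [← Complex.exp_add]
    congr 1
    push_cast
    field_simp
    ring
  rw [h2, smul_eq_mul, Complex.real_smul]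
  push_cast
  field_simp

/-- **`stub_hbPoisson`** (Poisson summation in the phase variable). For `Φ ∈ C¹`, `Φ' ≥ b > 0`,
`Φ' ≤ C(1 + log(1+|x|))`, the level sequence `Φ(t m) = π(m + 1/2)` and a Weil test `g`: if all
aliasing integrals `∫ ĝ Φ' e^{-2inΦ}` (`n ≠ 0`) vanish, then `Σ_m ĝ(t m) = (1/π) ∫ ĝ Φ'` as a
`HasSum` over `ℤ`, `ĝ(x) = weilMellin g (1/2 + xI)`. [folklore] -/
theorem stub_hbPoisson : ∀ {b : ℝ} (hb : 0 < b) {Φ : ℝ → ℝ} (hΦ : ContDiff ℝ 1 Φ)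
    (hΦb : ∀ x, b ≤ deriv Φ x) (hΦg : ∃ C : ℝ, ∀ x, deriv Φ x ≤ C * (1 + Real.log (1 + |x|)))
    {t : ℤ → ℝ} (ht : ∀ m : ℤ, Φ (t m) = π * (m + 1 / 2)) {g : ℝ → ℂ} (hg : IsWeilTest g)
    (halias : ∀ n : ℤ, n ≠ 0 → ∫ x : ℝ, weilMellin g (1 / 2 + x * I) * ((deriv Φ x : ℝ) : ℂ) *
      Complex.exp (-(2 * I * n * Φ x)) = 0),
    HasSum (fun m : ℤ => weilMellin g (1 / 2 + (t m : ℂ) * I))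
      ((1 / π : ℂ) * ∫ x : ℝ, weilMellin g (1 / 2 + x * I) * ((deriv Φ x : ℝ) : ℂ)) := by
  intro b hb Φ hΦ hΦb hΦg t ht g hg halias
  obtain ⟨C, hC⟩ := hΦg
  have hCpos : 0 < C := by
    have h := (hΦb 0).trans (hC 0)
    simp only [abs_zero, add_zero, Real.log_one, mul_one] at h
    exact hb.trans_le h
  obtain ⟨Ψ, hΨc, -, hΨΦ, hΦΨ⟩ := hbPoisson_exists_inverse hb hΦ hΦb
  have hmono : StrictMono Φ := strictMono_of_deriv_pos fun x ↦ hb.trans_le (hΦb x)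
  -- the function to which Poisson summation is applied
  set G : ℝ → ℂ := fun x ↦ weilMellin g (1 / 2 + x * I) with hG
  set f : ℝ → ℂ := fun u ↦ G (Ψ (π * (u + 1 / 2))) with hf
  have hGc : Continuous G :=
    (continuous_weilMellin hg.1.continuous hg.2).comp
      (by fun_prop : Continuous fun x : ℝ ↦ (1 / 2 : ℂ) + x * I)
  have hfc : Continuous f :=
    hGc.comp (hΨc.comp (by fun_prop : Continuous fun u : ℝ ↦ π * (u + 1 / 2)))
  have hgrowth : ∀ x, |Φ x - Φ 0| ≤ 2 * C * (1 + x ^ 2) := fun x ↦ by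
    have h := hbPoisson_abs_sub_le hΦ (fun y ↦ hb.le.trans (hΦb y)) hC x
    have h2 : (1 + |x|) * |x| ≤ 2 * (1 + x ^ 2) := by
      nlinarith [abs_nonneg x, sq_abs x, sq_nonneg (|x| - 1)]
    nlinarith
  have hfO : f =O[cocompact ℝ] fun u : ℝ ↦ |u| ^ (-2 : ℝ) :=
    hbPoisson_isBigO hCpos (ClosedLadder.norm_weilMellin_line_le_sq hg) hgrowth hΦΨ
  have hFf : ∀ w : ℝ, 𝓕 f w = cexp (π * w * I) / π *
      ∫ x : ℝ, G x * ((deriv Φ x : ℝ) : ℂ) * cexp (-(2 * I * w * Φ x)) :=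
    hbPoisson_fourier_eq hΦ hmono hΨΦ hΦΨ G
  have hFf0 : ∀ n : ℤ, n ≠ 0 → 𝓕 f n = 0 := fun n hn ↦ by
    have h := halias n hn
    rw [hFf]
    simp only [hG, ofReal_intCast]
    rw [h, mul_zero]
  have hsum : HasSum (fun n : ℤ ↦ 𝓕 f n) (𝓕 f ((0 : ℤ) : ℝ)) := hasSum_single 0 hFf0
  have hpoisson :=
    Real.tsum_eq_tsum_fourier_of_rpow_decay_of_summable hfc one_lt_two hfO hsum.summable 0
  simp only [zero_add, QuotientAddGroup.mk_zero, fourier_eval_zero, mul_one] at hpoisson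
  rw [hsum.tsum_eq, Int.cast_zero] at hpoisson
  -- summability of `m ↦ f m`
  have hfs : Summable fun m : ℤ ↦ f m :=
    summable_of_isBigO (Real.summable_abs_int_rpow one_lt_two)
      (hfO.comp_tendsto Int.tendsto_coe_cofinite)
  have key : HasSum (fun m : ℤ ↦ f m) (𝓕 f 0) := hpoisson ▸ hfs.hasSum
  have hfm : ∀ m : ℤ, f m = weilMellin g (1 / 2 + (t m : ℂ) * I) := fun m ↦ by
    simp only [hf, hG]
    rw [← ht m, hΨΦ]
  have hF0 : 𝓕 f 0 =
      (1 / π : ℂ) * ∫ x : ℝ, weilMellin g (1 / 2 + x * I) * ((deriv Φ x : ℝ) : ℂ) := by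
    rw [hFf 0]
    simp [hG]
  simp only [hfm, hF0] at key
  exact key

end Summit.RiemannHypothesis.RiemannHypothesis.Theorems.SpectralThesis.Sketch

end
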